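import Summits.AnomalousDissipation.AnomalousDissipation.Theorems.SolenoidalFractalHomogenisationLagrangianCarrierConstructionTowerStepA
import Summits.AnomalousDissipation.AnomalousDissipation.Theorems.SolenoidalFractalHomogenisationLagrangianCarrierConstructionTowerStepB
import HarnessLib

/-!
# K3L `LagrangianCarrierConstruction` (stmt-AnomalousDissipation-24913), line `birth`, stub `stub_flowsL`:
# the Lagrangian tower at every order of smoothness (helper; `--supports stmt-AnomalousDissipation-24913`)

Summits-side helper file (everything proved; no definitions, no named facts). The re-registered stub `stub_flowsL` (skeleton r22/v4) asks
for the per-level regularity package `LevelRegular`, in particular `Torus.IsSmooth` (all orders) of the level fields and displacements. This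
file repeats the `C¹` structure lemmas of `…TowerStepA` / `…TowerStepB` at an arbitrary order `n ≥ 1`: `C^n`-with-`C^n`-inverse is preserved
by `trans`, by the accumulation recursion and by the window formula; the window formula and its inverse are jointly `C^n` on every time slab
on which the coarse flow and the Eulerian field are (one-sided slabs at every time, two-sided off the break times). Infrastructure for the
construction side of route-1's rung leaf F-D1.A0 (a frontier formal rung); NOT a proof of anomalous dissipation.
-/

set_option linter.dupNamespace false

noncomputable section

namespace Summit.AnomalousDissipation.AnomalousDissipation.Theorems.SolenoidalFractalHomogenisation.LagrangianCarrierConstruction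

open Set Function Filter Topology Metric
open scoped NNReal
open Literature.Analysis.ODE Literature.Analysis.FunctionSpaces

section SmoothnessN

variable {V : Type*} [NormedAddCommGroup V] [NormedSpace ℝ V] {n : WithTop ℕ∞}

/-- `trans` preserves `C^n`-with-`C^n`-inverse. [folklore] -/
theorem contDiff_trans_n {e f : V ≃ V} (he : ContDiff ℝ n e ∧ ContDiff ℝ n e.symm)
    (hf : ContDiff ℝ n f ∧ ContDiff ℝ n f.symm) : ContDiff ℝ n (e.trans f) ∧ ContDiff ℝ n (e.trans f).symm := by
  refine ⟨?_, ?_⟩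
  · rw [Equiv.coe_trans]; exact hf.1.comp he.1
  · have h : ⇑(e.trans f).symm = e.symm ∘ f.symm := by funext z; simp
    rw [h]; exact he.2.comp hf.2

/-- A bijection and its inverse: swapping the roles (order `n`). [folklore] -/
theorem contDiff_symm_n {e : V ≃ V} (he : ContDiff ℝ n e ∧ ContDiff ℝ n e.symm) :
    ContDiff ℝ n e.symm ∧ ContDiff ℝ n e.symm.symm := by
  rw [Equiv.symm_symm]; exact ⟨he.2, he.1⟩

/-- **The accumulated window maps and their inverses are `C^n`** when the transition maps are. [folklore] -/
theorem contDiff_chain_n (C M : ℤ → V ≃ V) (hC0 : C 0 = Equiv.refl _) (hC : ∀ j : ℤ, C (j + 1) = (C j).trans (M j))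
    (hM : ∀ j : ℤ, ContDiff ℝ n (M j) ∧ ContDiff ℝ n (M j).symm) :
    ∀ j : ℤ, ContDiff ℝ n (C j) ∧ ContDiff ℝ n (C j).symm :=
  chain_induction C M (P := fun e => ContDiff ℝ n e ∧ ContDiff ℝ n e.symm) hC0 hC
    (by rw [Equiv.refl_symm]; exact ⟨contDiff_id, contDiff_id⟩) (fun j e he => contDiff_trans_n he (hM j))
    (fun j e he => contDiff_trans_n he (contDiff_symm_n (hM j)))

/-- The window formula and its inverse are `C^n` when its factors are. [folklore] -/
theorem contDiff_window_formula_n (A : ℝ → V ≃ V) (Z : ℝ → ℝ → V ≃ V) (C : V ≃ V)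
    (hA : ∀ t, ContDiff ℝ n (A t) ∧ ContDiff ℝ n (A t).symm) (hZ : ∀ t s, ContDiff ℝ n (Z t s) ∧ ContDiff ℝ n (Z t s).symm)
    (hCj : ContDiff ℝ n C ∧ ContDiff ℝ n C.symm) (t s : ℝ) :
    ContDiff ℝ n (C.trans ((Z t s).trans ((A s).symm.trans (A t)))) ∧
      ContDiff ℝ n (C.trans ((Z t s).trans ((A s).symm.trans (A t)))).symm :=
  contDiff_trans_n hCj (contDiff_trans_n (hZ t s) (contDiff_trans_n (contDiff_symm_n (hA s)) (hA t)))

end SmoothnessN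

section SlabsN

variable {V : Type*} [NormedAddCommGroup V] [NormedSpace ℝ V] [CompleteSpace V]
variable {v : ℝ → V → V} {n : ℕ∞}

/-- **Joint `C^n` of the window formula on a `C^n` slab.** [folklore] -/
theorem contDiffOn_window_formula_slab_n (hn : 1 ≤ n) (hv : IsUniformlyLipschitzOn v univ)
    (hloc : ∀ r : ℝ, ∃ ε > 0, ContDiffOn ℝ n (uncurry v) (Icc r (r + ε) ×ˢ univ) ∧
      ContDiffOn ℝ n (uncurry v) (Icc (r - ε) r ×ˢ univ))
    {S : Set ℝ} (hS : Convex ℝ S) (hSu : UniqueDiffOn ℝ S) (hvS : ContDiffOn ℝ n (uncurry v) (S ×ˢ univ))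
    {r : ℝ} (hr : r ∈ S) (A : ℝ → V ≃ V) (hAS : ContDiffOn ℝ n (fun p : ℝ × V => A p.1 p.2) (S ×ˢ univ))
    (s : ℝ) (hAs : ContDiff ℝ n (A s).symm) (C : V ≃ V) (hC : ContDiff ℝ n C) :
    ContDiffOn ℝ n (fun p : ℝ × V => A p.1 ((A s).symm (evolutionMap v s p.1 (C p.2)))) (S ×ˢ univ) := by
  have hZ := contDiffOn_evolutionMap_uncurry_of_local hv hn hloc hS hSu hvS hr s
  -- inner map `p ↦ (p.1, (A s)⁻¹ (φ(p.1, s, C p.2)))`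
  have h1 : ContDiffOn ℝ n (fun p : ℝ × V => ((p.1, C p.2) : ℝ × V)) (S ×ˢ univ) :=
    (contDiff_fst.prodMk (hC.comp contDiff_snd)).contDiffOn
  have h2 : ContDiffOn ℝ n (fun p : ℝ × V => evolutionMap v s p.1 (C p.2)) (S ×ˢ univ) :=
    hZ.comp h1 fun p hp => ⟨hp.1, mem_univ _⟩
  have h3 : ContDiffOn ℝ n (fun p : ℝ × V => ((p.1, (A s).symm (evolutionMap v s p.1 (C p.2))) : ℝ × V))
      (S ×ˢ univ) := contDiffOn_fst.prodMk (hAs.comp_contDiffOn h2)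
  exact hAS.comp h3 fun p hp => ⟨hp.1, mem_univ _⟩

/-- **Joint `C^n` of the inverse window formula on a `C^n` slab.** [folklore] -/
theorem contDiffOn_window_formula_symm_slab_n (hn : 1 ≤ n) (hv : IsUniformlyLipschitzOn v univ)
    (hloc : ∀ r : ℝ, ∃ ε > 0, ContDiffOn ℝ n (uncurry v) (Icc r (r + ε) ×ˢ univ) ∧
      ContDiffOn ℝ n (uncurry v) (Icc (r - ε) r ×ˢ univ))
    {S : Set ℝ} (hS : Convex ℝ S) (hSu : UniqueDiffOn ℝ S) (hvS : ContDiffOn ℝ n (uncurry v) (S ×ˢ univ))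
    {r : ℝ} (hr : r ∈ S) (A : ℝ → V ≃ V) (hAS : ContDiffOn ℝ n (fun p : ℝ × V => (A p.1).symm p.2) (S ×ˢ univ))
    (s : ℝ) (hAs : ContDiff ℝ n (A s)) (C : V ≃ V) (hC : ContDiff ℝ n C.symm) :
    ContDiffOn ℝ n (fun p : ℝ × V => C.symm (evolutionMap v p.1 s (A s ((A p.1).symm p.2)))) (S ×ˢ univ) := by
  have hZ := contDiffOn_evolutionMap_initial_of_local hv hn hloc hS hSu hvS hr s
  have h1 : ContDiffOn ℝ n (fun p : ℝ × V => ((p.1, A s ((A p.1).symm p.2)) : ℝ × V)) (S ×ˢ univ) :=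
    contDiffOn_fst.prodMk (hAs.comp_contDiffOn hAS)
  have h2 : ContDiffOn ℝ n (fun p : ℝ × V => evolutionMap v p.1 s (A s ((A p.1).symm p.2))) (S ×ˢ univ) :=
    hZ.comp h1 fun p hp => ⟨hp.1, mem_univ _⟩
  exact hC.comp_contDiffOn h2

/-- **One-sided slabs for the window formula at every time** (intersection of the one-sided slabs of the coarse flow and
of the Eulerian field). [folklore] -/
theorem exists_slabs_window_formula_n (hn : 1 ≤ n) (hv : IsUniformlyLipschitzOn v univ)
    (hloc : ∀ r : ℝ, ∃ ε > 0, ContDiffOn ℝ n (uncurry v) (Icc r (r + ε) ×ˢ univ) ∧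
      ContDiffOn ℝ n (uncurry v) (Icc (r - ε) r ×ˢ univ))
    (A : ℝ → V ≃ V)
    (h3 : ∀ r, ∃ ε > 0, ContDiffOn ℝ n (fun p : ℝ × V => A p.1 p.2) (Icc r (r + ε) ×ˢ univ) ∧
      ContDiffOn ℝ n (fun p : ℝ × V => A p.1 p.2) (Icc (r - ε) r ×ˢ univ))
    (h3' : ∀ r, ∃ ε > 0, ContDiffOn ℝ n (fun p : ℝ × V => (A p.1).symm p.2) (Icc r (r + ε) ×ˢ univ) ∧
      ContDiffOn ℝ n (fun p : ℝ × V => (A p.1).symm p.2) (Icc (r - ε) r ×ˢ univ))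
    (hA : ∀ t, ContDiff ℝ n (A t) ∧ ContDiff ℝ n (A t).symm)
    (C : V ≃ V) (hC : ContDiff ℝ n C ∧ ContDiff ℝ n C.symm) (s r : ℝ) :
    ∃ ε > 0,
      ContDiffOn ℝ n (fun p : ℝ × V => A p.1 ((A s).symm (evolutionMap v s p.1 (C p.2)))) (Icc r (r + ε) ×ˢ univ) ∧
      ContDiffOn ℝ n (fun p : ℝ × V => A p.1 ((A s).symm (evolutionMap v s p.1 (C p.2)))) (Icc (r - ε) r ×ˢ univ) ∧
      ContDiffOn ℝ n (fun p : ℝ × V => C.symm (evolutionMap v p.1 s (A s ((A p.1).symm p.2))))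
        (Icc r (r + ε) ×ˢ univ) ∧
      ContDiffOn ℝ n (fun p : ℝ × V => C.symm (evolutionMap v p.1 s (A s ((A p.1).symm p.2))))
        (Icc (r - ε) r ×ˢ univ) := by
  obtain ⟨ε₁, hε₁, hv₁, hv₂⟩ := hloc r
  obtain ⟨ε₂, hε₂, hA₁, hA₂⟩ := h3 r
  obtain ⟨ε₃, hε₃, hA₃, hA₄⟩ := h3' r
  set ε := min ε₁ (min ε₂ ε₃) with hε
  have hε0 : 0 < ε := lt_min hε₁ (lt_min hε₂ hε₃)
  have e1 : ε ≤ ε₁ := min_le_left _ _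
  have e2 : ε ≤ ε₂ := le_trans (min_le_right _ _) (min_le_left _ _)
  have e3 : ε ≤ ε₃ := le_trans (min_le_right _ _) (min_le_right _ _)
  have hR : ∀ {δ}, ε ≤ δ → Icc r (r + ε) ×ˢ (univ : Set V) ⊆ Icc r (r + δ) ×ˢ univ := fun h =>
    prod_mono (Icc_subset_Icc le_rfl (by linarith)) le_rfl
  have hL : ∀ {δ}, ε ≤ δ → Icc (r - ε) r ×ˢ (univ : Set V) ⊆ Icc (r - δ) r ×ˢ univ := fun h =>
    prod_mono (Icc_subset_Icc (by linarith) le_rfl) le_rfl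
  have hrR : r ∈ Icc r (r + ε) := ⟨le_rfl, by linarith⟩
  have hrL : r ∈ Icc (r - ε) r := ⟨by linarith, le_rfl⟩
  have hSuR : UniqueDiffOn ℝ (Icc r (r + ε)) := uniqueDiffOn_Icc (by linarith)
  have hSuL : UniqueDiffOn ℝ (Icc (r - ε) r) := uniqueDiffOn_Icc (by linarith)
  refine ⟨ε, hε0, ?_, ?_, ?_, ?_⟩
  · exact contDiffOn_window_formula_slab_n hn hv hloc (convex_Icc _ _) hSuR (hv₁.mono (hR e1)) hrR A (hA₁.mono (hR e2)) s
      (hA s).2 C hC.1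
  · exact contDiffOn_window_formula_slab_n hn hv hloc (convex_Icc _ _) hSuL (hv₂.mono (hL e1)) hrL A (hA₂.mono (hL e2)) s
      (hA s).2 C hC.1
  · exact contDiffOn_window_formula_symm_slab_n hn hv hloc (convex_Icc _ _) hSuR (hv₁.mono (hR e1)) hrR A (hA₃.mono (hR e3))
      s (hA s).1 C hC.2
  · exact contDiffOn_window_formula_symm_slab_n hn hv hloc (convex_Icc _ _) hSuL (hv₂.mono (hL e1)) hrL A (hA₄.mono (hL e3))
      s (hA s).1 C hC.2

/-- **Two-sided slabs for the window formula** at times where both the coarse flow and the Eulerian field are two-sided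
smooth. [folklore] -/
theorem exists_two_sided_slab_window_formula_n (hn : 1 ≤ n) (hv : IsUniformlyLipschitzOn v univ)
    (hloc : ∀ r : ℝ, ∃ ε > 0, ContDiffOn ℝ n (uncurry v) (Icc r (r + ε) ×ˢ univ) ∧
      ContDiffOn ℝ n (uncurry v) (Icc (r - ε) r ×ˢ univ))
    (A : ℝ → V ≃ V) (hA : ∀ t, ContDiff ℝ n (A t) ∧ ContDiff ℝ n (A t).symm)
    (C : V ≃ V) (hC : ContDiff ℝ n C ∧ ContDiff ℝ n C.symm) (s : ℝ) {t : ℝ}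
    (hvt : ∃ ε > 0, ContDiffOn ℝ n (uncurry v) (Icc (t - ε) (t + ε) ×ˢ univ))
    (hAt : ∃ ε > 0, ContDiffOn ℝ n (fun p : ℝ × V => A p.1 p.2) (Icc (t - ε) (t + ε) ×ˢ univ))
    (hAt' : ∃ ε > 0, ContDiffOn ℝ n (fun p : ℝ × V => (A p.1).symm p.2) (Icc (t - ε) (t + ε) ×ˢ univ)) :
    ∃ ε > 0,
      ContDiffOn ℝ n (fun p : ℝ × V => A p.1 ((A s).symm (evolutionMap v s p.1 (C p.2))))
        (Icc (t - ε) (t + ε) ×ˢ univ) ∧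
      ContDiffOn ℝ n (fun p : ℝ × V => C.symm (evolutionMap v p.1 s (A s ((A p.1).symm p.2))))
        (Icc (t - ε) (t + ε) ×ˢ univ) := by
  obtain ⟨ε₁, hε₁, hv₁⟩ := hvt
  obtain ⟨ε₂, hε₂, hA₁⟩ := hAt
  obtain ⟨ε₃, hε₃, hA₃⟩ := hAt'
  set ε := min ε₁ (min ε₂ ε₃) with hε
  have hε0 : 0 < ε := lt_min hε₁ (lt_min hε₂ hε₃)
  have e1 : ε ≤ ε₁ := min_le_left _ _
  have e2 : ε ≤ ε₂ := le_trans (min_le_right _ _) (min_le_left _ _)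
  have e3 : ε ≤ ε₃ := le_trans (min_le_right _ _) (min_le_right _ _)
  have hT : ∀ {δ}, ε ≤ δ → Icc (t - ε) (t + ε) ×ˢ (univ : Set V) ⊆ Icc (t - δ) (t + δ) ×ˢ univ := fun h =>
    prod_mono (Icc_subset_Icc (by linarith) (by linarith)) le_rfl
  have ht : t ∈ Icc (t - ε) (t + ε) := ⟨by linarith, by linarith⟩
  have hSu : UniqueDiffOn ℝ (Icc (t - ε) (t + ε)) := uniqueDiffOn_Icc (by linarith)
  refine ⟨ε, hε0, ?_, ?_⟩
  · exact contDiffOn_window_formula_slab_n hn hv hloc (convex_Icc _ _) hSu (hv₁.mono (hT e1)) ht A (hA₁.mono (hT e2)) s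
      (hA s).2 C hC.1
  · exact contDiffOn_window_formula_symm_slab_n hn hv hloc (convex_Icc _ _) hSu (hv₁.mono (hT e1)) ht A (hA₃.mono (hT e3))
      s (hA s).1 C hC.2


end SlabsN

end Summit.AnomalousDissipation.AnomalousDissipation.Theorems.SolenoidalFractalHomogenisation.LagrangianCarrierConstruction

end
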